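import Literature.Probability.RandomPlanarGeometry.Staircase
import HarnessLib

/-!
# The boundary lattice paths of the disc approximations `D^m` ([LSW04] §4.3)

From the quarter staircase `quarter m` (`Staircase.lean`, from `(m, 0)` to `(0, m)` outside the
circle of radius `m`) we assemble, by the symmetries `x ↦ -x` and `y ↦ -y` of the problem, the
data of the lattice domain `D^m = D(α^m, β^m, a^m, b^m) ∈ 𝔇*` approximating the disc of radius
`m` with marked points `m · 1` and `m · (-1)` (`SmoothDomain.unitDisc` scaled by `R = m`):

* `alphaPath m = quarter m ++ mirror (reverse (quarter m))` without the repeated top vertex — the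
  primal (wired) staircase from `α_a = (m, 0)` over the top to `α_b = (-m, 0)` (`4m + 1` vertices);
* `betaPath m` — the dual (free) staircase from `β_a = (m - ½, -½)` under the bottom to
  `β_b = (-m + ½, -½)`, as dual indices: the images of the quarter under
  `(x, y) ↦ (x - 1, -y - 1)` (dual point `(x - ½, -y - ½)`) followed by the images under
  `(x, y) ↦ (-x, -y - 1)` (dual point `(-x + ½, -y - ½)`) of the reversed quarter without its two
  top vertices (`4m` vertices);
* `aIdx m = (2m - 1, -1)`, `bIdx m = (-2m, -1)` — the Peano vertices `a^m = (m - ¼, -¼)`,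
  `b^m = (-m + ¼, -¼)`; their primal / dual neighbours are the endpoints of the two paths
  (`primalNbr_aIdx`, …, `getLast_betaPath`);
* the chain, membership and cross-product facts consumed by the `USTPeano.Domain` instance and
  the approximation bounds (`USTPeanoDiscApproximation.lean`): `isChain_latticeAdj_alphaPath/betaPath`,
  `mem_alphaPath_iff`, `mem_betaPath`, `isChain_cross_alphaPath` (every step of `α` is seen
  counterclockwise from `0` with integer cross product `≥ 1`), `isChain_cross_betaPath` (every
  step of `β`, traversed backwards as in the boundary cycle, has `4 ×` cross product `≥ 2`).

All proofs are index-free (`List.IsChain`, `List.Mem` through `map`/`append`/`reverse`/`drop`).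
-/

namespace Literature.Probability.RandomPlanarGeometry

namespace USTPeano

open List

variable {m : ℕ}

/-! ### Symmetries on indices -/

/-- Mirror in the `y`-axis on primal indices: `(x, y) ↦ (-x, y)`. [folklore] -/
def mirrorP (p : ℤ × ℤ) : ℤ × ℤ := (-p.1, p.2)

/-- Primal index `(x, y)` ↦ the dual index of the point `(x - ½, -y - ½)` (reflection in the
`x`-axis of the dual vertex up-left of `(x, y)`). [folklore] -/
def flipR (p : ℤ × ℤ) : ℤ × ℤ := (p.1 - 1, -p.2 - 1)

/-- Primal index `(x, y)` ↦ the dual index of the point `(-x + ½, -y - ½)` (the mirror image of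
`flipR`). [folklore] -/
def flipL (p : ℤ × ℤ) : ℤ × ℤ := (-p.1, -p.2 - 1)

/-- Value of `mirrorP`. [folklore] -/
@[simp] theorem mirrorP_apply (x y : ℤ) : mirrorP (x, y) = (-x, y) := rfl

/-- Value of `flipR`. [folklore] -/
@[simp] theorem flipR_apply (x y : ℤ) : flipR (x, y) = (x - 1, -y - 1) := rfl

/-- Value of `flipL`. [folklore] -/
@[simp] theorem flipL_apply (x y : ℤ) : flipL (x, y) = (-x, -y - 1) := rfl

/-! ### The primal path `α` -/

/-- **The wired lattice path `α^m`**: the quarter staircase from `(m, 0)` up to `(0, m)` followed by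
its mirror image down to `(-m, 0)`. [folklore] -/
def alphaPath (m : ℕ) : List (ℤ × ℤ) :=
  quarter m ++ ((quarter m).reverse.tail).map mirrorP

/-- `α^m` is nonempty. [folklore] -/
theorem alphaPath_ne_nil (m : ℕ) : alphaPath m ≠ [] := by simp [alphaPath, quarter_ne_nil]

/-- `α^m` starts at `α_a = (m, 0)`. [folklore] -/
theorem head_alphaPath (hm : 1 ≤ m) : (alphaPath m).head (alphaPath_ne_nil m) = ((m : ℤ), 0) := by
  simp only [alphaPath]
  rw [List.head_append_of_ne_nil (quarter_ne_nil m), head_quarter hm]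

/-- `α^m` ends at `α_b = (-m, 0)`. [folklore] -/
theorem getLast_alphaPath (hm : 2 ≤ m) :
    (alphaPath m).getLast (alphaPath_ne_nil m) = (-(m : ℤ), 0) := by
  have hne : ((quarter m).reverse.tail).map mirrorP ≠ [] := by
    rw [quarter_eq hm]; simp
  simp only [alphaPath]
  rw [List.getLast_append_of_ne_nil _ hne, List.getLast_map, List.getLast_tail,
    List.getLast_reverse, head_quarter (by omega)]
  simp

/-- The vertices of `α^m`: the quarter and its mirror image. [folklore] -/
theorem mem_alphaPath {p : ℤ × ℤ} (hp : p ∈ alphaPath m) :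
    p ∈ quarter m ∨ ∃ q ∈ quarter m, p = mirrorP q := by
  simp only [alphaPath, List.mem_append, List.mem_map] at hp
  rcases hp with h | ⟨q, hq, rfl⟩
  · exact Or.inl h
  · exact Or.inr ⟨q, List.mem_reverse.1 (List.mem_of_mem_tail hq), rfl⟩

/-- **Vertex bounds for `α^m`**: `|x| ≤ m`, `0 ≤ y ≤ m`, `m² ≤ x² + y² < (m+2)²`. [folklore] -/
theorem mem_alphaPath_bounds {p : ℤ × ℤ} (hp : p ∈ alphaPath m) :
    -(m : ℤ) ≤ p.1 ∧ p.1 ≤ m ∧ 0 ≤ p.2 ∧ p.2 ≤ m ∧ (m : ℤ) ^ 2 ≤ p.1 ^ 2 + p.2 ^ 2 ∧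
      p.1 ^ 2 + p.2 ^ 2 < ((m : ℤ) + 2) ^ 2 := by
  rcases mem_alphaPath hp with h | ⟨q, hq, rfl⟩
  · obtain ⟨h1, h2, h3, h4, h5, h6⟩ := mem_quarter_bounds h
    exact ⟨by linarith, h2, h3, h4, h5, h6⟩
  · obtain ⟨h1, h2, h3, h4, h5, h6⟩ := mem_quarter_bounds hq
    simp only [mirrorP]
    refine ⟨by linarith, by linarith, h3, h4, by nlinarith, by nlinarith⟩

/-- **The step relation of `α^m`** with the sign information of its two halves: an `UpLeft` step
between points of the closed first quadrant, or the mirror image of one traversed backwards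
between points of the closed second quadrant. [folklore] -/
def AStep (p q : ℤ × ℤ) : Prop :=
  (UpLeft p q ∧ 0 ≤ p.1 ∧ 0 ≤ p.2) ∨ (UpLeft (mirrorP q) (mirrorP p) ∧ q.1 ≤ 0 ∧ 0 ≤ q.2)

/-- `α`-steps are lattice steps. [folklore] -/
theorem AStep.latticeAdj {p q : ℤ × ℤ} (h : AStep p q) : LatticeAdj p q := by
  rcases h with ⟨h, -⟩ | ⟨h, -⟩
  · exact h.latticeAdj
  · have := h.latticeAdj
    unfold LatticeAdj at this ⊢
    simp only [mirrorP] at this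
    omega

/-- `α`-steps are seen counterclockwise from the origin: integer cross product `≥ 1`. [folklore] -/
theorem AStep.one_le_cross {p q : ℤ × ℤ} (h : AStep p q) : 1 ≤ p.1 * q.2 - p.2 * q.1 := by
  rcases h with ⟨h, hp⟩ | ⟨h, hq⟩
  · exact h.one_le_cross hp
  · have := h.one_le_cross (by simp [mirrorP]; exact ⟨hq.1, hq.2⟩)
    simp only [mirrorP] at this
    linarith

/-- **`α^m` is a chain of `AStep`s.** [folklore] -/
theorem isChain_aStep_alphaPath (hm : 2 ≤ m) : (alphaPath m).IsChain AStep := by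
  have hq : (quarter m).IsChain fun p q ↦ UpLeft p q ∧ 0 ≤ p.1 ∧ 0 ≤ p.2 :=
    (isChain_upLeft_quarter (by omega)).imp_of_mem_imp fun x _ hx _ h ↦
      ⟨h, (mem_quarter_bounds hx).1, (mem_quarter_bounds hx).2.2.1⟩
  rw [alphaPath, List.isChain_append]
  refine ⟨hq.imp fun _ _ h ↦ Or.inl h, ?_, ?_⟩
  · -- the mirrored reversed tail
    rw [List.isChain_map]
    have h2 : (quarter m).IsChain fun p q ↦ AStep (mirrorP q) (mirrorP p) :=
      (isChain_upLeft_quarter (by omega)).imp_of_mem_imp fun x _ hx _ h ↦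
        Or.inr ⟨by simpa [mirrorP] using h, by simp [mirrorP]; exact (mem_quarter_bounds hx).1,
          by simp [mirrorP]; exact (mem_quarter_bounds hx).2.2.1⟩
    exact (List.isChain_reverse.2 h2).tail
  · -- the junction `(0, m) → (-1, m)`: a left-step at height `m`
    intro p hp q hq
    rw [List.getLast?_eq_getLast_of_ne_nil (quarter_ne_nil m), Option.mem_def, Option.some.injEq,
      getLast_quarter] at hp
    subst hp
    have hq' : q = (-1, (m : ℤ)) := by
      rw [quarter_eq hm] at hq
      simp at hq
      rw [← hq]
    subst hq'
    have hm1 : (1 : ℤ) ≤ m := by exact_mod_cast (show 1 ≤ m by omega)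
    have hm0 : (0 : ℤ) ≤ m := by positivity
    exact Or.inl ⟨Or.inr ⟨by simp, hm1⟩, le_rfl, hm0⟩

/-- `α^m` is a lattice path. [folklore] -/
theorem isChain_latticeAdj_alphaPath (hm : 2 ≤ m) : (alphaPath m).IsChain LatticeAdj :=
  (isChain_aStep_alphaPath hm).imp fun _ _ h ↦ h.latticeAdj

/-- Every step of `α^m` is seen counterclockwise from the origin (integer cross product `≥ 1`).
[folklore] -/
theorem isChain_cross_alphaPath (hm : 2 ≤ m) :
    (alphaPath m).IsChain fun p q ↦ 1 ≤ p.1 * q.2 - p.2 * q.1 :=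
  (isChain_aStep_alphaPath hm).imp fun _ _ h ↦ h.one_le_cross

/-! ### The dual path `β` -/

/-- **The free lattice path `β^m`** (dual indices): the quarter mapped by `flipR` (dual points
`(x - ½, -y - ½)`, from `β_a = (m - ½, -½)` down to `(-½, -m - ½)`), followed by the reversed
quarter without its two top vertices mapped by `flipL` (dual points `(-x + ½, -y - ½)`, from
`(-3/2, -m - ½)` up to `β_b = (-m + ½, -½)`). [folklore] -/
def betaPath (m : ℕ) : List (ℤ × ℤ) :=
  (quarter m).map flipR ++ (((quarter m).reverse).drop 2).map flipL

/-- `β^m` is nonempty. [folklore] -/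
theorem betaPath_ne_nil (m : ℕ) : betaPath m ≠ [] := by simp [betaPath, quarter_ne_nil]

/-- `β^m` starts at the dual index `(m - 1, -1)` of `β_a = (m - ½, -½)`. [folklore] -/
theorem head_betaPath (hm : 1 ≤ m) : (betaPath m).head (betaPath_ne_nil m) = ((m : ℤ) - 1, -1) := by
  simp only [betaPath]
  rw [List.head_append_of_ne_nil (by simp [quarter_ne_nil]), List.head_map, head_quarter hm]
  simp

/-- `β^m` ends at the dual index `(-m, -1)` of `β_b = (-m + ½, -½)` (`m ≥ 3`). [folklore] -/
theorem getLast_betaPath (hm : 3 ≤ m) :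
    (betaPath m).getLast (betaPath_ne_nil m) = (-(m : ℤ), -1) := by
  have hne : (((quarter m).reverse).drop 2).map flipL ≠ [] := by
    rw [reverse_quarter_drop_two (by omega)]; simp [colRun_ne_nil]
  simp only [betaPath]
  rw [List.getLast_append_of_ne_nil _ hne, List.getLast_map]
  have : (((quarter m).reverse).drop 2).getLast (by simpa using hne) = ((m : ℤ), 0) := by
    simp only [reverse_quarter_drop_two (show 2 ≤ m by omega), List.getLast_reverse]
    exact head_columns_append_colRun_two hm
  rw [this]
  simp

/-- The vertices of `β^m` come from the quarter through `flipR` or `flipL`. [folklore] -/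
theorem mem_betaPath {p : ℤ × ℤ} (hp : p ∈ betaPath m) :
    ∃ q ∈ quarter m, p = flipR q ∨ p = flipL q := by
  simp only [betaPath, List.mem_append, List.mem_map] at hp
  rcases hp with ⟨q, hq, rfl⟩ | ⟨q, hq, rfl⟩
  · exact ⟨q, hq, Or.inl rfl⟩
  · exact ⟨q, List.mem_reverse.1 (List.mem_of_mem_drop hq), Or.inr rfl⟩

/-- **The step relation of `β^m` read backwards** (as the boundary cycle traverses it), with
`4 ×` the cross product of the corresponding dual points: for consecutive `u, v` in `β^m`,
`(2 v₁ + 1)(2 u₂ + 1) - (2 v₂ + 1)(2 u₁ + 1) ≥ 2` and `u, v` are lattice neighbours. [folklore] -/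
def BStep (u v : ℤ × ℤ) : Prop :=
  LatticeAdj u v ∧ 2 ≤ (2 * v.1 + 1) * (2 * u.2 + 1) - (2 * v.2 + 1) * (2 * u.1 + 1)

/-- An `UpLeft` step of the first quadrant, pushed through `flipR`, is a `BStep`. [folklore] -/
theorem bStep_flipR {p q : ℤ × ℤ} (h : UpLeft p q) (hp : 0 ≤ p.1 ∧ 0 ≤ p.2) :
    BStep (flipR p) (flipR q) := by
  have hc := h.one_le_cross hp
  obtain ⟨hp1, hp2⟩ := hp
  rcases h with ⟨rfl, h1⟩ | ⟨rfl, h1⟩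
  · refine ⟨Or.inl ⟨rfl, Or.inr (by simp [flipR]; ring)⟩, ?_⟩
    simp only [flipR]
    nlinarith
  · refine ⟨Or.inr ⟨by simp [flipR], Or.inr (by simp [flipR])⟩, ?_⟩
    simp only [flipR]
    nlinarith

/-- An `UpLeft` step `v → u` of the first quadrant, pushed through `flipL` and reversed, is a
`BStep`. [folklore] -/
theorem bStep_flipL {u v : ℤ × ℤ} (h : UpLeft v u) (hv : 0 ≤ v.1 ∧ 0 ≤ v.2) :
    BStep (flipL u) (flipL v) := by
  have hc := h.one_le_cross hv
  obtain ⟨hv1, hv2⟩ := hv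
  rcases h with ⟨rfl, h1⟩ | ⟨rfl, h1⟩
  · refine ⟨Or.inl ⟨by simp [flipL], Or.inl (by simp [flipL]; ring)⟩, ?_⟩
    simp only [flipL]
    nlinarith
  · refine ⟨Or.inr ⟨by simp [flipL], Or.inr (by simp [flipL]; ring)⟩, ?_⟩
    simp only [flipL]
    nlinarith

/-- **`β^m` is a chain of `BStep`s** (`m ≥ 3`). [folklore] -/
theorem isChain_bStep_betaPath (hm : 3 ≤ m) : (betaPath m).IsChain BStep := by
  have hq : (quarter m).IsChain fun p q ↦ UpLeft p q ∧ 0 ≤ p.1 ∧ 0 ≤ p.2 :=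
    (isChain_upLeft_quarter (by omega)).imp_of_mem_imp fun x _ hx _ h ↦
      ⟨h, (mem_quarter_bounds hx).1, (mem_quarter_bounds hx).2.2.1⟩
  rw [betaPath, List.isChain_append]
  refine ⟨?_, ?_, ?_⟩
  · rw [List.isChain_map]
    exact hq.imp fun p q h ↦ bStep_flipR h.1 h.2
  · rw [List.isChain_map]
    refine ((List.isChain_reverse.2 ?_).drop 2).imp fun u v h ↦ h
    exact hq.imp fun v u h ↦ bStep_flipL h.1 h.2
  · -- the junction `(-½, -m-½) ← (-3/2, -m-½)` in the middle of the bottom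
    intro p hp q hq'
    rw [List.getLast?_eq_getLast_of_ne_nil (by simp [quarter_ne_nil]), Option.mem_def,
      Option.some.injEq, List.getLast_map, getLast_quarter] at hp
    have hne2 : (columns m (m - 2) ++ colRun m 2).reverse ≠ [] := by simp [colRun_ne_nil]
    rw [reverse_quarter_drop_two (by omega), List.head?_map, List.head?_eq_some_head hne2] at hq'
    simp only [Option.map_some, Option.mem_def, Option.some.injEq, List.head_reverse] at hq'
    rw [List.getLast_append_of_ne_nil _ (colRun_ne_nil _ _), getLast_colRun_two (by omega)] at hq'
    subst hp; subst hq'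
    refine ⟨Or.inr ⟨by simp, Or.inr (by simp)⟩, ?_⟩
    simp only [flipR_apply, flipL_apply]
    nlinarith

/-- For consecutive `u, v` in `β^m`, `u` and `v` are lattice neighbours. [folklore] -/
theorem isChain_latticeAdj_betaPath (hm : 3 ≤ m) : (betaPath m).IsChain LatticeAdj :=
  (isChain_bStep_betaPath hm).imp fun _ _ h ↦ h.1

/-- **Vertex bounds for `β^m`** (dual indices `(i, j)`, dual point `(i + ½, j + ½)`):
`-m ≤ i ≤ m - 1`, `-m - 1 ≤ j ≤ -1`, and `4 m² - 4 m + 2 ≤ (2i+1)² + (2j+1)² < 4 (m + 3)²`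
(the dual point lies in the annulus between the circles of radii `m - ½` and `m + 3`).
[folklore] -/
theorem mem_betaPath_bounds (hm : 1 ≤ m) {p : ℤ × ℤ} (hp : p ∈ betaPath m) :
    -(m : ℤ) ≤ p.1 ∧ p.1 ≤ m - 1 ∧ -(m : ℤ) - 1 ≤ p.2 ∧ p.2 ≤ -1 ∧
      4 * (m : ℤ) ^ 2 - 4 * m + 2 ≤ (2 * p.1 + 1) ^ 2 + (2 * p.2 + 1) ^ 2 ∧
      (2 * p.1 + 1) ^ 2 + (2 * p.2 + 1) ^ 2 < 4 * ((m : ℤ) + 3) ^ 2 := by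
  have hm' : (1 : ℤ) ≤ m := by exact_mod_cast hm
  obtain ⟨q, hq, h⟩ := mem_betaPath hp
  obtain ⟨h1, h2, h3, h4, h5, h6⟩ := mem_quarter_bounds hq
  rcases h with rfl | rfl
  · simp only [flipR]
    refine ⟨by linarith, by linarith, by linarith, by linarith, by nlinarith, by nlinarith⟩
  · simp only [flipL]
    refine ⟨by linarith, by linarith, by linarith, by linarith, by nlinarith, by nlinarith⟩

/-! ### The marked Peano vertices -/

/-- The Peano index of `a^m = (m - ¼, -¼)`. [folklore] -/
def aIdx (m : ℕ) : ℤ × ℤ := (2 * m - 1, -1)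

/-- The Peano index of `b^m = (-m + ¼, -¼)`. [folklore] -/
def bIdx (m : ℕ) : ℤ × ℤ := (-2 * m, -1)

/-- `α_a = (m, 0)`. [folklore] -/
theorem primalNbr_aIdx (m : ℕ) : primalNbr (aIdx m) = ((m : ℤ), 0) := by
  unfold primalNbr aIdx; ext
  · simp
  · simp

/-- `β_a` has dual index `(m - 1, -1)` (the point `(m - ½, -½)`). [folklore] -/
theorem dualNbr_aIdx (m : ℕ) : dualNbr (aIdx m) = ((m : ℤ) - 1, -1) := by
  unfold dualNbr aIdx; ext
  · simp; omega
  · simp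

/-- `α_b = (-m, 0)`. [folklore] -/
theorem primalNbr_bIdx (m : ℕ) : primalNbr (bIdx m) = (-(m : ℤ), 0) := by
  unfold primalNbr bIdx; ext
  · simp; omega
  · simp

/-- `β_b` has dual index `(-m, -1)` (the point `(-m + ½, -½)`). [folklore] -/
theorem dualNbr_bIdx (m : ℕ) : dualNbr (bIdx m) = (-(m : ℤ), -1) := by
  unfold dualNbr bIdx; ext
  · simp; omega
  · simp

/-- `a^m = (m - ¼, -¼)`. [folklore] -/
theorem peanoPt_aIdx (m : ℕ) : peanoPt (aIdx m) = ⟨(m : ℝ) - 1 / 4, -(1 / 4)⟩ := by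
  apply Complex.ext <;> simp [aIdx] <;> ring

/-- `b^m = (-m + ¼, -¼)`. [folklore] -/
theorem peanoPt_bIdx (m : ℕ) : peanoPt (bIdx m) = ⟨-(m : ℝ) + 1 / 4, -(1 / 4)⟩ := by
  apply Complex.ext <;> simp [bIdx] <;> ring

/-! ### Counting vertices -/

/-- A vertical run of `n` points has length `n`. [folklore] -/
@[simp] theorem length_vrun (x y₀ : ℤ) (n : ℕ) : (vrun x y₀ n).length = n := by
  induction n generalizing y₀ with
  | zero => rfl
  | succ n ih => simp [vrun, ih]

/-- The concatenated columns telescope: `|columns m k| = H (m - k) + k` (`k ≤ m`). [folklore] -/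
theorem length_columns : ∀ {k : ℕ}, k ≤ m →
    ((columns m k).length : ℤ) = colHeight m ((m : ℤ) - k) + k
  | 0, _ => by simp [columns, colHeight_self]
  | k + 1, hk => by
    have ih := length_columns (k := k) (by omega)
    have hle := colHeight_le_pred (m := m) (x := (m : ℤ) - k) (by omega)
    simp only [columns, List.length_append, colRun, length_vrun, Nat.cast_add, Nat.cast_one, ih]
    rw [Int.toNat_of_nonneg (by linarith)]
    ring_nf

/-- **The quarter has `2m + 1` vertices.** [folklore] -/
theorem length_quarter (m : ℕ) : (quarter m).length = 2 * m + 1 := by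
  have h := length_columns (m := m) (k := m) le_rfl
  rw [sub_self, colHeight_zero] at h
  have : (columns m m).length = 2 * m := by omega
  simp [quarter, this]

/-- `α^m` has `4m + 1` vertices. [folklore] -/
theorem length_alphaPath (m : ℕ) : (alphaPath m).length = 4 * m + 1 := by
  simp [alphaPath, length_quarter]; omega

/-- `β^m` has `4m` vertices (`m ≥ 1`). [folklore] -/
theorem length_betaPath (hm : 1 ≤ m) : (betaPath m).length = 4 * m := by
  simp [betaPath, length_quarter]; omega

end USTPeano

end Literature.Probability.RandomPlanarGeometry
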